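import Mathlib
import Literature.NumberTheory.LFunctions.HalaszRestrictedMeanSquare
import HarnessLib
import Summits.RiemannHypothesis.RiemannHypothesis.Theorems.IntegerScrewBirthIdentity
import Summits.RiemannHypothesis.RiemannHypothesis.Theorems.IntegerScrewEMertBound
import Summits.RiemannHypothesis.RiemannHypothesis.Theorems.IntegerScrewReturnTransfer

/-!
# Route `IntegerScrew` — THEOREM C♯, LOWER HALF, UNCONDITIONALLY IN THE KERNEL:
# `p⁰₁₁(τ/log M) ≥ e^{−16τ/log M}·g(τ)` for every `M ≥ 2`, `τ > 0`

PIVOT-LAW 13.44 / CONTINUUM-LIMIT §16 (THEOREM C♯) proves the two-sided return law of the truncated multiplicative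
walk of 13.10 in the window `t = τ/log M`: `g(τ)e^{−ε⁻_Lτ} ≤ p⁰₁₁(τ/L) ≤ g(τ)e^{ε⁺_Lτ}`, `ε^± = O(1/L)`.  This file
closes the LOWER half in the kernel with the explicit constant `ε⁻_L = 16/L`, using only facts PROVED in the tree:

1. the exact decomposition 16.4 (`IntegerScrewBirthIdentity.generator_sub_deriv_eq`):
   `births + deaths − ∂_u h̃ = Π·Σ_{q ≤ M/x}Σ_{a ≤ log_q(M/x)} (log q/(q^aL))·[K(u,ρ−aθ_q)χ_q − K(u,ρ)] − I(u,ρ)Π`;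
2. the per-term lower bounds (here): for `a = 1`, `K(u,ρ−θ_q)χ_q − K ≥ F(θ_q)` in BOTH cases `χ_q ∈ {1, φ(θ_q)}`
   (so the `C_px` subtraction of 16.5 is unnecessary for the lower bound); for `a ≥ 2`, `≥ −K·log q/q^a`;
3. the prime-power tail (here): `Σ_{q ≤ Y prime} Σ_{2 ≤ a ≤ A_q} log q/q^a ≤ 8` (`q^{−a} ≤ (4/q²)2^{−a}`,
   `Σ_{a≥2}2^{−a} ≤ ½`, `log q ≤ 2√q`, `Σ_{n≥2} n^{−3/2} ≤ 2` by telescoping);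
4. 16.5 (a) unconditionally (`IntegerScrewEMertBound.prime_sum_bracketF_sub_integral_bounds`, from the abstract
   Mertens–Abel lemma `IntegerScrewMertensAbel` and the tree's `−4 ≤ ϑ₁ − log ≤ 0`): `Σ_q (log q/q)F(θ_q) − L·I ≥ −8K`;
5. the transfer skeleton `IntegerScrewReturnTransfer.returnProb_ge_of_sixteen_four`.

RESULTS: `sixteen_five_lower` — for `2 ≤ M`, `u > 0`, `1 ≤ x ≤ M`: `births + deaths − ∂_u h̃ ≥ −(16/log M)·h̃(u;x)`;
**`theorem returnProb_ge_csharp` — for `2 ≤ M`, `τ > 0`: `e^{−(16/log M)τ}·g(τ) ≤ (e^{τ·walkGen M})₁₁`**, i.e.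
THEOREM C♯'s lower bound `p⁰₁₁(τ/log M) ≥ g(τ)e^{−16τ/log M}` with `(E₂, κ₀) = (4, 2)` constants (printed: `3.4/L`).
RH-free; nothing here bears on the truth of RH.  References: CONTINUUM-LIMIT §16, §23.11; PIVOT-LAW 13.44, 13.49–13.52;
M. Suzuki, J. Lond. Math. Soc. (2) 108 (2023) 1448–1487 [Suzuki2023].
-/

noncomputable section

-- D-0017: `Summit.<S>.<S>.…` is the designed namespace of a single-problem summit.
set_option linter.dupNamespace false

namespace Summit.RiemannHypothesis.RiemannHypothesis.Theorems.IntegerScrew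

open Real Finset

/-! ## 3. The prime-power tail `Σ_q Σ_{a ≥ 2} log q/q^a ≤ 8` -/

/-- `q^{−a} ≤ (4/q²)·(1/2)^a` for `q ≥ 2`, `a ≥ 2` (`q^a = q²·q^{a−2} ≥ q²·2^{a−2}`). -/
theorem inv_pow_le_of_two_le {q : ℝ} (hq : 2 ≤ q) {a : ℕ} (ha : 2 ≤ a) :
    (q ^ a)⁻¹ ≤ 4 / q ^ 2 * (1 / 2) ^ a := by
  obtain ⟨k, rfl⟩ := Nat.exists_eq_add_of_le ha
  have hq0 : 0 < q := by linarith
  have h2k : (2 : ℝ) ^ k ≤ q ^ k := pow_le_pow_left₀ (by norm_num) hq k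
  have e1 : (q ^ (2 + k))⁻¹ = (q ^ 2)⁻¹ * (q ^ k)⁻¹ := by rw [pow_add, mul_inv]
  have e2 : 4 / q ^ 2 * ((1 : ℝ) / 2) ^ (2 + k) = (q ^ 2)⁻¹ * (2 ^ k)⁻¹ := by
    rw [pow_add, one_div_pow, one_div_pow]
    field_simp
    ring
  rw [e1, e2]
  exact mul_le_mul_of_nonneg_left (inv_anti₀ (by positivity) h2k) (by positivity)

/-- `Σ_{a ∈ Icc 2 A} (1/2)^a ≤ 1/2`. -/
theorem sum_Icc_two_half_pow_le (A : ℕ) : ∑ a ∈ Finset.Icc 2 A, ((1 : ℝ) / 2) ^ a ≤ 1 / 2 := by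
  rcases Nat.lt_or_ge A 2 with hA | hA
  · rw [Finset.Icc_eq_empty_of_lt hA, Finset.sum_empty]; norm_num
  · have h : Finset.Icc 2 A = Finset.Ico 2 (A + 1) := by
      ext a; simp only [Finset.mem_Icc, Finset.mem_Ico]; omega
    rw [h, Finset.sum_Ico_eq_sum_range]
    have : ∑ k ∈ Finset.range (A + 1 - 2), ((1 : ℝ) / 2) ^ (2 + k) =
        (1 / 4) * ∑ k ∈ Finset.range (A + 1 - 2), ((1 : ℝ) / 2) ^ k := by
      rw [Finset.mul_sum]
      refine Finset.sum_congr rfl fun k _ => ?_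
      rw [pow_add]; norm_num
    rw [this]
    have hg := sum_geometric_two_le (A + 1 - 2)
    linarith

/-- Per prime: `Σ_{a ∈ Icc 2 A} log q/q^a ≤ 4/(q·√q)` for a prime (indeed any real) `q ≥ 2`. -/
theorem sum_Icc_two_log_div_pow_le {q : ℝ} (hq : 2 ≤ q) (A : ℕ) :
    ∑ a ∈ Finset.Icc 2 A, Real.log q / q ^ a ≤ 4 / (q * Real.sqrt q) := by
  have hq0 : 0 < q := by linarith
  have hlog0 : 0 ≤ Real.log q := Real.log_nonneg (by linarith)
  -- log q ≤ 2 √q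
  have hlog : Real.log q ≤ 2 * Real.sqrt q := by
    have h := Real.log_le_rpow_div hq0.le one_half_pos
    rw [← Real.sqrt_eq_rpow] at h
    linarith
  have hsq : 0 < Real.sqrt q := Real.sqrt_pos.mpr hq0
  have hsq2 : Real.sqrt q * Real.sqrt q = q := Real.mul_self_sqrt hq0.le
  calc ∑ a ∈ Finset.Icc 2 A, Real.log q / q ^ a
      = Real.log q * ∑ a ∈ Finset.Icc 2 A, (q ^ a)⁻¹ := by
        rw [Finset.mul_sum]; refine Finset.sum_congr rfl fun a _ => ?_; rw [div_eq_mul_inv]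
    _ ≤ Real.log q * ∑ a ∈ Finset.Icc 2 A, 4 / q ^ 2 * (1 / 2) ^ a := by
        refine mul_le_mul_of_nonneg_left (Finset.sum_le_sum fun a ha => ?_) hlog0
        exact inv_pow_le_of_two_le hq (Finset.mem_Icc.mp ha).1
    _ = Real.log q * (4 / q ^ 2) * ∑ a ∈ Finset.Icc 2 A, ((1 : ℝ) / 2) ^ a := by
        rw [Finset.mul_sum, Finset.mul_sum]
        refine Finset.sum_congr rfl fun a _ => ?_
        ring
    _ ≤ 2 * Real.sqrt q * (4 / q ^ 2) * (1 / 2) := by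
        gcongr
        · exact sum_Icc_two_half_pow_le A
    _ = 4 / (q * Real.sqrt q) := by
        field_simp
        nlinarith [hsq2]

/-- `Σ_{n ∈ Icc 2 Y} 1/(n√n) ≤ 2 − 2/√Y ≤ 2` (`Y ≥ 1`). -/
theorem sum_Icc_two_inv_mul_sqrt_le (Y : ℕ) (hY : 1 ≤ Y) :
    ∑ n ∈ Finset.Icc 2 Y, 1 / ((n : ℝ) * Real.sqrt n) ≤ 2 - 2 / Real.sqrt Y := by
  induction Y, hY using Nat.le_induction with
  | base => simp
  | succ Y hY ih =>
      rw [Finset.sum_Icc_succ_top (by omega : 2 ≤ Y + 1)]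
      have hstep := Literature.NumberTheory.LFunctions.Halasz.Restricted.inv_mul_sqrt_le_sub (m := (Y : ℝ)) (by exact_mod_cast hY)
      push_cast at hstep ⊢
      linarith

/-- **The prime-power tail**: `Σ_{q ≤ Y prime} Σ_{a ∈ Icc 2 (A q)} log q/q^a ≤ 8` for any exponent bounds `A q`. -/
theorem primePower_tail_le_eight (Y : ℕ) (A : ℕ → ℕ) :
    ∑ q ∈ (Finset.Icc 1 Y).filter Nat.Prime, ∑ a ∈ Finset.Icc 2 (A q), Real.log q / (q : ℝ) ^ a ≤ 8 := by
  rcases Nat.eq_zero_or_pos Y with rfl | hY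
  · simp
  calc ∑ q ∈ (Finset.Icc 1 Y).filter Nat.Prime, ∑ a ∈ Finset.Icc 2 (A q), Real.log q / (q : ℝ) ^ a
      ≤ ∑ q ∈ (Finset.Icc 1 Y).filter Nat.Prime, 4 / ((q : ℝ) * Real.sqrt q) := by
        refine Finset.sum_le_sum fun q hq => ?_
        have hq2 : (2 : ℝ) ≤ q := by exact_mod_cast (Finset.mem_filter.mp hq).2.two_le
        exact sum_Icc_two_log_div_pow_le hq2 (A q)
    _ ≤ ∑ n ∈ Finset.Icc 2 Y, 4 / ((n : ℝ) * Real.sqrt n) := by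
        refine Finset.sum_le_sum_of_subset_of_nonneg ?_ fun n _ _ => by positivity
        intro q hq
        have h := Finset.mem_filter.mp hq
        exact Finset.mem_Icc.mpr ⟨h.2.two_le, (Finset.mem_Icc.mp h.1).2⟩
    _ = 4 * ∑ n ∈ Finset.Icc 2 Y, 1 / ((n : ℝ) * Real.sqrt n) := by
        rw [Finset.mul_sum]; refine Finset.sum_congr rfl fun n _ => ?_; ring
    _ ≤ 4 * (2 - 2 / Real.sqrt Y) := by
        gcongr; exact sum_Icc_two_inv_mul_sqrt_le Y hY
    _ ≤ 8 := by
        have : 0 ≤ 2 / Real.sqrt Y := by positivity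
        linarith

/-! ## 2. Per-term lower bounds for the (q,a)-sum of 16.4 -/

/-- `χ_q ≥ 0` (`L ≥ 0`, `u ≥ 0`). -/
theorem birthChi_nonneg {L u : ℝ} (hL : 0 ≤ L) (hu : 0 ≤ u) (x q : ℕ) : 0 ≤ birthChi L u x q := by
  unfold birthChi
  split_ifs
  · exact zero_le_one
  · rw [sub_nonneg, Real.exp_le_one_iff, neg_nonpos]
    exact mul_nonneg hu (div_nonneg (Real.log_natCast_nonneg q) hL)
  
/-- `χ_q ≥ φ(θ_q)` (the present-prime case has `χ = 1 ≥ φ`). -/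
theorem phi_le_birthChi (L u : ℝ) (x q : ℕ) : 1 - Real.exp (-(u * (Real.log q / L))) ≤ birthChi L u x q := by
  unfold birthChi
  split_ifs
  · linarith [Real.exp_pos (-(u * (Real.log q / L)))]
  · exact le_rfl

/-- **a = 1**: `K(u,ρ−θ_q)χ_q − K ≥ F(θ_q) = K(u,ρ−θ_q)φ(θ_q) − K` (`u > 0`; both cases of `χ_q`). -/
theorem term_one_ge_bracketF {L u : ℝ} (hu : 0 < u) (x q : ℕ) (ρ : ℝ) :
    ccpK u (ρ - Real.log q / L) * (1 - Real.exp (-(u * (Real.log q / L)))) - ccpK u ρ ≤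
      ccpK u (ρ - 1 * (Real.log q / L)) * birthChi L u x q - ccpK u ρ := by
  rw [one_mul]
  have hK := (ccpK_pos hu (ρ - Real.log q / L)).le
  have := mul_le_mul_of_nonneg_left (phi_le_birthChi L u x q) hK
  linarith

/-- **a ≥ 2** (indeed any `a`): `K(u,ρ−aθ_q)χ_q − K ≥ −K` (`u > 0`, `L ≥ 0`). -/
theorem term_ge_neg_ccpK {L u : ℝ} (hL : 0 ≤ L) (hu : 0 < u) (x q a : ℕ) (ρ : ℝ) :
    -ccpK u ρ ≤ ccpK u (ρ - a * (Real.log q / L)) * birthChi L u x q - ccpK u ρ := by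
  have := mul_nonneg (ccpK_pos hu (ρ - a * (Real.log q / L))).le (birthChi_nonneg hL hu.le x q)
  linarith

/-- The inner `a`-sum of 16.4 for one prime `q ≤ M/x`, bounded below (`L > 0`, `u > 0`):
`Σ_{a ∈ Icc 1 A} (log q/(q^aL))[K(ρ−aθ_q)χ_q − K] ≥ (log q/(qL))·F(θ_q) − (K/L)·Σ_{a ∈ Icc 2 A} log q/q^a` (`A ≥ 1`). -/
theorem inner_sum_ge {L u : ℝ} (hL : 0 < L) (hu : 0 < u) (x q : ℕ) (hq : q.Prime) {A : ℕ} (hA : 1 ≤ A)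
    (ρ : ℝ) :
    Real.log q / ((q : ℝ) * L) *
        (ccpK u (ρ - Real.log q / L) * (1 - Real.exp (-(u * (Real.log q / L)))) - ccpK u ρ)
      - ccpK u ρ / L * ∑ a ∈ Finset.Icc 2 A, Real.log q / (q : ℝ) ^ a ≤
      ∑ a ∈ Finset.Icc 1 A, Real.log q / ((q : ℝ) ^ a * L) *
        (ccpK u (ρ - a * (Real.log q / L)) * birthChi L u x q - ccpK u ρ) := by
  have hq0 : (0 : ℝ) < q := by exact_mod_cast hq.pos
  have hlog : 0 ≤ Real.log q := Real.log_natCast_nonneg q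
  rw [← Finset.add_sum_Ioc_eq_sum_Icc hA, show Finset.Ioc 1 A = Finset.Icc 2 A by
    ext a; simp [Finset.mem_Ioc, Finset.mem_Icc]; omega]
  -- a = 1 term
  have h1 : Real.log q / ((q : ℝ) * L) *
      (ccpK u (ρ - Real.log q / L) * (1 - Real.exp (-(u * (Real.log q / L)))) - ccpK u ρ) ≤
      Real.log q / ((q : ℝ) ^ 1 * L) * (ccpK u (ρ - (1 : ℕ) * (Real.log q / L)) * birthChi L u x q - ccpK u ρ) := by
    rw [pow_one, Nat.cast_one]
    exact mul_le_mul_of_nonneg_left (term_one_ge_bracketF hu x q ρ) (by positivity)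
  -- a ≥ 2 terms
  have h2 : -(ccpK u ρ / L * ∑ a ∈ Finset.Icc 2 A, Real.log q / (q : ℝ) ^ a) ≤
      ∑ a ∈ Finset.Icc 2 A, Real.log q / ((q : ℝ) ^ a * L) *
        (ccpK u (ρ - a * (Real.log q / L)) * birthChi L u x q - ccpK u ρ) := by
    rw [Finset.mul_sum, ← Finset.sum_neg_distrib]
    refine Finset.sum_le_sum fun a _ => ?_
    have ht := term_ge_neg_ccpK hL.le hu x q a ρ
    have hw : 0 ≤ Real.log q / ((q : ℝ) ^ a * L) := by positivity
    calc -(ccpK u ρ / L * (Real.log q / (q : ℝ) ^ a))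
        = Real.log q / ((q : ℝ) ^ a * L) * (-ccpK u ρ) := by field_simp
      _ ≤ Real.log q / ((q : ℝ) ^ a * L) * (ccpK u (ρ - a * (Real.log q / L)) * birthChi L u x q - ccpK u ρ) :=
          mul_le_mul_of_nonneg_left ht hw
  linarith

/-! ## The assembled lower bound of 16.5 (UNCONDITIONAL, `ε⁻_L = 16/L`) -/

/-- `(Icc 1 n).filter Prime = primesLE n`. -/
theorem filter_prime_Icc_one (n : ℕ) : (Finset.Icc 1 n).filter Nat.Prime = Nat.primesLE n := by
  rw [Nat.primesLE_eq_filter_Ioc_zero]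
  congr 1

/-- **16.5, lower half, in the kernel.** For `2 ≤ M`, `u > 0`, `1 ≤ x ≤ M`, with `L = log M`:
`births + deaths − ∂_u h̃ ≥ −(16/L)·h̃(u;x)`. -/
theorem sixteen_five_lower {M : ℕ} (hM : 2 ≤ M) {u : ℝ} (hu : 0 < u) {x : ℕ} (hx : x ∈ Finset.Icc 1 M) :
    -(16 / Real.log M * hTilde (Real.log M) u x) ≤
      (∑ n ∈ Finset.Icc 1 (M / x), (ArithmeticFunction.vonMangoldt n : ℝ) / ((n : ℝ) * Real.log M) *
          (hTilde (Real.log M) u (x * n) - hTilde (Real.log M) u x)) +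
        (∑ d ∈ x.divisors, (ArithmeticFunction.vonMangoldt d : ℝ) / Real.log M *
          (hTilde (Real.log M) u (x / d) - hTilde (Real.log M) u x)) -
        hTildeDeriv (Real.log M) u x := by
  obtain ⟨hx1, hxM⟩ := Finset.mem_Icc.mp hx
  set L := Real.log M with hLdef
  have hL : 0 < L := Real.log_pos (by exact_mod_cast (by omega : 1 < M))
  have hx0 : x ≠ 0 := by omega
  set ρ := room L x with hρdef
  rw [generator_sub_deriv_eq L hu.ne' hx0]
  -- the (q,a)-sum, bounded below prime by prime
  have hsum : (∑ q ∈ (Finset.Icc 1 (M / x)).filter Nat.Prime,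
        (Real.log q / ((q : ℝ) * L) *
            (ccpK u (ρ - Real.log q / L) * (1 - Real.exp (-(u * (Real.log q / L)))) - ccpK u ρ)
          - ccpK u ρ / L * ∑ a ∈ Finset.Icc 2 (Nat.log q (M / x)), Real.log q / (q : ℝ) ^ a)) ≤
      ∑ q ∈ (Finset.Icc 1 (M / x)).filter Nat.Prime, ∑ a ∈ Finset.Icc 1 (Nat.log q (M / x)),
        Real.log q / ((q : ℝ) ^ a * L) * (ccpK u (ρ - a * (Real.log q / L)) * birthChi L u x q - ccpK u ρ) := by
    refine Finset.sum_le_sum fun q hq => ?_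
    have hqP : q.Prime := (Finset.mem_filter.mp hq).2
    have hqle : q ≤ M / x := (Finset.mem_Icc.mp (Finset.mem_filter.mp hq).1).2
    have hA : 1 ≤ Nat.log q (M / x) := by
      rw [Nat.one_le_iff_ne_zero, ne_eq, Nat.log_eq_zero_iff, not_or, not_lt]
      exact ⟨hqle, by have := hqP.two_le; omega⟩
    exact inner_sum_ge hL hu x q hqP hA ρ
  rw [Finset.sum_sub_distrib] at hsum
  -- the F-part is (1/L)·(Σ_{primesLE} (log q/q) F) and the tail is ≤ 8K/L
  have hF : ∑ q ∈ (Finset.Icc 1 (M / x)).filter Nat.Prime, Real.log q / ((q : ℝ) * L) *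
        (ccpK u (ρ - Real.log q / L) * (1 - Real.exp (-(u * (Real.log q / L)))) - ccpK u ρ) =
      (1 / L) * ∑ q ∈ Nat.primesLE (M / x), Real.log q / q *
        (ccpK u (ρ - Real.log q / L) * (1 - Real.exp (-(u * (Real.log q / L)))) - ccpK u ρ) := by
    rw [← filter_prime_Icc_one, Finset.mul_sum]
    refine Finset.sum_congr rfl fun q _ => ?_
    field_simp
  have htail : ∑ q ∈ (Finset.Icc 1 (M / x)).filter Nat.Prime,
        ccpK u ρ / L * ∑ a ∈ Finset.Icc 2 (Nat.log q (M / x)), Real.log q / (q : ℝ) ^ a ≤ 8 * ccpK u ρ / L := by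
    rw [← Finset.mul_sum]
    have h8 := primePower_tail_le_eight (M / x) (fun q => Nat.log q (M / x))
    have hKL : 0 ≤ ccpK u ρ / L := div_nonneg (ccpK_pos hu ρ).le hL.le
    calc ccpK u ρ / L * _ ≤ ccpK u ρ / L * 8 := mul_le_mul_of_nonneg_left h8 hKL
      _ = 8 * ccpK u ρ / L := by ring
  -- E_Mert unconditionally
  have hE := (prime_sum_bracketF_sub_integral_bounds hM hx1 hxM hu).1
  -- assemble: Π ≥ 0, h̃ = K Π
  have hPi : 0 ≤ primeProd L u x := primeProd_nonneg hL.le hu.le x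
  have hKρ := (ccpK_pos hu ρ).le
  have hmain : -(16 / L * ccpK u ρ) ≤
      (∑ q ∈ (Finset.Icc 1 (M / x)).filter Nat.Prime, ∑ a ∈ Finset.Icc 1 (Nat.log q (M / x)),
        Real.log q / ((q : ℝ) ^ a * L) * (ccpK u (ρ - a * (Real.log q / L)) * birthChi L u x q - ccpK u ρ))
        - ccpI u ρ := by
    have hE' : -(8 * ccpK u ρ) / L ≤ (1 / L) * (∑ q ∈ Nat.primesLE (M / x), Real.log q / q *
        (ccpK u (ρ - Real.log q / L) * (1 - Real.exp (-(u * (Real.log q / L)))) - ccpK u ρ)) - ccpI u ρ := by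
      rw [div_le_iff₀ hL]
      have key : ∀ S I : ℝ, ((1 / L) * S - I) * L = S - L * I := by
        intro S I; field_simp
      rw [key]
      linarith
    rw [hF] at hsum
    have : -(16 / L * ccpK u ρ) = -(8 * ccpK u ρ) / L - 8 * ccpK u ρ / L := by ring
    rw [this]
    linarith
  have := mul_le_mul_of_nonneg_right hmain hPi
  unfold hTilde
  rw [← hρdef]
  have e1 : -(16 / L * ccpK u ρ) * primeProd L u x = -(16 / L * (ccpK u ρ * primeProd L u x)) := by ring
  rw [e1] at this
  linarith [this]

/-- **THEOREM C♯, LOWER HALF (kernel, unconditional).** For every `M ≥ 2` and `τ > 0`: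
`e^{−(16/log M)·τ}·g(τ) ≤ (e^{τ·𝒜_M})₁₁ = P_1(X_{τ/log M} = 1)` — the truncated multiplicative walk of
PIVOT-LAW 13.10 returns at least `e^{−16τ/log M}` times as often as its continuum limit `g(τ) = ∫₀²|1−λ|e^{−τλ}dλ`. -/
theorem returnProb_ge_csharp {M : ℕ} (hM : 2 ≤ M) {τ : ℝ} (hτ : 0 < τ) :
    Real.exp (-(16 / Real.log M * τ)) * ccpg τ ≤
      (NormedSpace.exp (τ • walkGen M)) (stOne (by omega : 1 ≤ M)) (stOne (by omega : 1 ≤ M)) :=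
  returnProb_ge_of_sixteen_four (by omega) hτ fun u hu x hx => sixteen_five_lower hM hu hx

end Summit.RiemannHypothesis.RiemannHypothesis.Theorems.IntegerScrew

end
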